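import Summits.QuantumFields.YangMills.Theorems.AlphaInputsT3ACMinimiserPinKnit
import Summits.QuantumFields.YangMills.Theorems.AlphaInputsT3ACv3ProfileRecord
import HarnessLib

/-!
# `AlphaInputsT3ACMinimiserPinKnitRec` — THE KNIT AT RECORD LEVEL AND IN CLOSED FORM: 2′ `AlphaInputsT3ACv3Rec L` ⇐ ONE displayed predicate
# `AlphaInputsT3AC.PinnedPartsT3ACRec L` = «exact p-profile · [7] constants in print's small-`a₁` regime · `C68 ≥ c_min` (three inequalities LINEAR in `C68`) ·
# (T) [Balaban1985Variational] Thm 1 `Thm1GlobalMinAt L a₀ a₁ B₃` · (D6) non-emptiness of the adapted classes · (O″) the cluster-expansion data rows for SOME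
# pinned trivial-history family, GIVEN that one exists» — lane `pub-balaban3d`, seat alpha-1 (g7)

Cell `ym3-torus`, route `UnitScaleTilt`, crux 2′ `stub_laneRecordsV3` (stmt-QuantumFields-19936 ∕ -19935); owner DEPMAP v3 (ym3-torus STATUS 13:40:16Z) displays
2′ ⇐ `alphaInputsT3ACv3Rec_of_dataSchemaRec` ⇐ per family `AlphaInputsT3AC.dataSchemaT3AC_of_pinnedRows F 𝔠 hT hwin hA3 hA2 hB₃ hC hanti hsmall hD6 hrows`
(sibling `…MinimiserPinKnit`).  THIS FILE finishes the bookkeeping so that the display is ONE named predicate at the level of the registered text: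
* §1 CLOSED FORM of the two `γ`-rows of the knit.  `hanti` `(min γ₀ 1)² ≤ e^{2(1−p₀)}` and `hsmall` «every (40)-window of the record's coupling window is
  `≤ a₁`» follow from TWO inequalities LINEAR in `C68` — `e^{p₀−1} ≤ 3C₀(3)·C68·b₀Q₀(p₀)` and `b₀Q₀(p₀)·(2L²B)² ≤ 3C₀(3)·C68·a₁²` — by `…MinimiserPinConsts` §7
  (`γ ≤ (min γ₀ 1)² ≤ γ₀ ≤ (3C₀(3)C68 b₀Q₀)⁻²`) and the explicit threshold `T3Thresholds.θBal_le_of_le_gamma` (`θ(i) ≤ σ` once `γ ≤ (σ/(b₀Q₀))⁴`); with the knit's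
  `hC` `4B₃L²·avgWindowFactor(L) ≤ C68` all three are met by `C68 ≥ c_min(L, B₃, a₁, b₀, p₀)` (`MinimiserPin.sizes_of_C68_ge`, an explicit `max`).
* §2 THE KNIT IN CLOSED FORM WITH THE WEAKER DATA ROW (O″): `(∃ Ut, TrivMinimiserRowsT3 … Ut) → ∃ Ut, TrivMinimiserRowsT3 … Ut ∧ DataRowsT3 … Ut` — «given that SOME
  measurable pinned trivial-history minimiser family exists, the expansion supplies its data rows for a (possibly different, e.g. print's own axial-gauge analytic)
  pinned family».  (O″) is implied by the knit's universal row (O∀) `∀ Ut, Triv… Ut → Data… Ut` (`AlphaInputsT3AC.dataRowsGiven_of_forall`) and is EXACTLY print-strength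
  (the supplier may answer with its own selection) — this answers the owner's caveat (i) on DEPMAP v3 («`hrows` universal over every pinned family is stronger than
  needed») without a `def` of a selector: `AlphaInputsT3AC.dataSchemaT3AC_of_pinnedRows₂` ∕ `…ofV3At_of_pinnedRows₂`.
* §3 RECORD LEVEL: `AlphaInputsT3AC.PinnedPartsT3ACRec L` (hypothesis schema, OPEN) = the shell of `AlphaInputsT3ACv3Rec L` verbatim (`∃ b₁ p₁ ∀ b₀ p₀ ⪰ ∃ 𝔠 a₀ a₁,
  𝔠.b₀ = b₀ ∧ 𝔠.p₀ = p₀ ∧ 0 < a₀ ∧ 0 < a₁ ∧ B₃a₁ ≤ a₀ ∧ …`) whose body is: [7]'s small-`a₁` regime (`2B₃a₁` admissible for [Balaban1985Averaging] Prop. 2 on `7L`-cubes),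
  the record's sizes `1 ≤ 2B₃` and the three `C68`-inequalities, (T) `Thm1GlobalMinAt L a₀ a₁ 𝔠.B₃` ONCE (it depends on `L, a₀, a₁, B₃` only), and for every family of
  block size `L`: (D6) and (O″).  ★ `alphaInputsT3ACv3Rec_of_pinnedPartsRec : PinnedPartsT3ACRec L → AlphaInputsT3ACv3Rec L` (and `dataSchemaT3ACRec_of_pinnedPartsRec`).
* §4 THE SIZE ROWS ARE NEVER THE OBSTRUCTION: for every record `𝔠₀` and `a₁ > 0` there is a threshold `b₁` such that for every profile `b₀ ≥ b₁`, `p₀ ≥ 3` a record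
  with EXACTLY that profile, `B₃ = 𝔠₀.B₃` and all three `C68`-inequalities exists (`AlphaInputsT3AC.exists_record_sizes`, from alpha-2's
  `AlphaInputsT3AC.exists_alphaConsts_profile` with `c := c_min` at the target profile) — so the mass of `PinnedPartsT3ACRec` is (T) + (D6) + (O″), RIDER R-g17 of the
  negation memo g17 («the record at which (O) ∕ (D6) are supplied must already satisfy the `C68`-sizes») being automatic: the provider names `𝔠` with the sizes.
HONEST FRAMING.  Kernel theorems about the tree's own objects plus ONE hypothesis schema (`def … : Prop`, never asserted).  Nothing of the cluster expansion
([Balaban1985UV3] §§2–3) or of [Balaban1985Variational] Thm 1 is proved; (T), (D6), (O″) stay DISPLAYED; the data rows are displayed FOR pinned∕constructed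
minimisers (lane B's honesty line, unchanged).  Count-neutral helper toward 2′; not a claim about d = 4, the continuum limit, or the mass gap.
References: T. Bałaban, Commun. Math. Phys. 102 (1985) 255–275 [Balaban1985UV3], (7) p. 257, (40)–(42) p. 266, (68)–(71) p. 273, Thm 2 p. 272; Commun. Math.
Phys. 102 (1985) 277–309 [Balaban1985Variational], Thm 1 (6)–(8) pp. 278–279; Commun. Math. Phys. 98 (1985) 17–51 [Balaban1985Averaging], Prop. 2 p. 22.
-/

set_option autoImplicit false

noncomputable section

/-! ## §1 The two `γ`-rows of the knit in closed form -/

namespace Summit.QuantumFields.YangMills.Theorems.MinimiserPin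

open Literature.MathematicalPhysics.QuantumFieldTheory.Balaban1983to89
open Literature.MathematicalPhysics.QuantumFieldTheory.Balaban1983to89.T3UnitScaleTilt (θBal)
open Literature.MathematicalPhysics.QuantumFieldTheory.Balaban1983to89.T3Thresholds (θBal_le_of_le_gamma)
open Summit.QuantumFields.Balaban3D.Proofs.Primitives
open Summit.QuantumFields.Balaban3D.Proofs.Thresholds (Q0 Q0_pos)
open B7Prop2Explicit (C0 C0_pos)

section ClosedForm

variable {L N : ℕ} (𝔠 : AlphaConsts L N)

/-- The (71)-denominator `3C₀(3)·C68·b₀Q₀(p₀)` of the record is positive. [cite: Balaban1985UV3, (7) p.257 and (68)–(71) p.273 (bookkeeping)] -/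
theorem den71_pos : 0 < 3 * C0 3 * 𝔠.C68 * (𝔠.b₀ * Q0 𝔠.p₀) := by
  have := C0_pos 3
  have := 𝔠.C68_pos
  have := 𝔠.b₀_pos
  have := Q0_pos 𝔠.p₀_pos
  positivity

/-- **`hanti` IN CLOSED FORM**: `e^{p₀−1} ≤ 3C₀(3)·C68·b₀Q₀(p₀)` puts the record's coupling window inside the antitone regime of the thresholds,
`(min γ₀ 1)² ≤ e^{2(1−p₀)}` (`γ₀ ≤ (3C₀(3)C68 b₀Q₀)⁻² ≤ e^{2(1−p₀)}`). [cite: Balaban1985UV3, p.256 L15–18, (7) p.257 and (68)–(71) p.273 (bookkeeping)] -/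
theorem anti_of_C68 (hCe : Real.exp (𝔠.p₀ - 1) ≤ 3 * C0 3 * 𝔠.C68 * (𝔠.b₀ * Q0 𝔠.p₀)) :
    (min 𝔠.gamma0 1) ^ 2 ≤ Real.exp (2 * (1 - 𝔠.p₀)) := by
  refine window_le_of_C68 𝔠 le_rfl ?_
  have hinv : (3 * C0 3 * 𝔠.C68 * (𝔠.b₀ * Q0 𝔠.p₀))⁻¹ ≤ Real.exp (1 - 𝔠.p₀) := by
    have h := inv_anti₀ (Real.exp_pos _) hCe
    rwa [← Real.exp_neg, neg_sub] at h
  have h0 : 0 ≤ (3 * C0 3 * 𝔠.C68 * (𝔠.b₀ * Q0 𝔠.p₀))⁻¹ := (inv_pos.mpr (den71_pos 𝔠)).le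
  calc ((3 * C0 3 * 𝔠.C68 * (𝔠.b₀ * Q0 𝔠.p₀))⁻¹) ^ 2 ≤ (Real.exp (1 - 𝔠.p₀)) ^ 2 := pow_le_pow_left₀ h0 hinv 2
    _ = Real.exp (2 * (1 - 𝔠.p₀)) := by
        rw [show (2 : ℝ) * (1 - 𝔠.p₀) = ((2 : ℕ) : ℝ) * (1 - 𝔠.p₀) by norm_num, Real.exp_nat_mul]

/-- **`hsmall` IN CLOSED FORM**: `b₀Q₀(p₀)·(2L²B)² ≤ 3C₀(3)·C68·a₁²` gives `2L²·B·θBal L γ b₀ p₀ (K − k + 1) ≤ a₁` for every coupling `γ` of the record's window and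
all `K, k` — the record's window lies below the explicit threshold `(σ/(b₀Q₀))⁴`, `σ = a₁/(2L²B)`, of `T3Thresholds.θBal_le_of_le_gamma`.
[cite: Balaban1985UV3, (7) p.257, (40) p.266 and (68)–(71) p.273 (bookkeeping)] -/
theorem small_of_C68 (hL : 1 ≤ L) {a₁ B : ℝ} (ha₁ : 0 < a₁) (hB : 0 < B)
    (hCa : (𝔠.b₀ * Q0 𝔠.p₀) * (2 * (L : ℝ) ^ 2 * B) ^ 2 ≤ 3 * C0 3 * 𝔠.C68 * a₁ ^ 2) :
    ∀ γ : ℝ, 0 < γ → γ ≤ (min 𝔠.gamma0 1) ^ 2 → ∀ K k : ℕ, 2 * (L : ℝ) ^ 2 * B * θBal L γ 𝔠.b₀ 𝔠.p₀ (K - k + 1) ≤ a₁ := by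
  intro γ hγ hγ1 K k
  have hL0 : (0 : ℝ) < (L : ℝ) := by exact_mod_cast (show 0 < L by omega)
  have hW : 0 < 2 * (L : ℝ) ^ 2 * B := by positivity
  have hbQ : 0 < 𝔠.b₀ * Q0 𝔠.p₀ := mul_pos 𝔠.b₀_pos (Q0_pos 𝔠.p₀_pos)
  have hden := den71_pos 𝔠
  set σ : ℝ := a₁ / (2 * (L : ℝ) ^ 2 * B) with hσ_def
  have hσ : 0 ≤ σ := by positivity
  have hσW : σ * (2 * (L : ℝ) ^ 2 * B) = a₁ := by rw [hσ_def]; exact div_mul_cancel₀ _ hW.ne'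
  have hγ1' : γ ≤ 1 := hγ1.trans (sq_min_one_le _ 𝔠.gamma0_pos)
  -- the record's window is below the explicit threshold `((σ/(b₀Q₀))²)²`
  have hkey : (3 * C0 3 * 𝔠.C68 * (𝔠.b₀ * Q0 𝔠.p₀))⁻¹ ≤ (σ / (𝔠.b₀ * Q0 𝔠.p₀)) ^ 2 := by
    rw [div_pow, le_div_iff₀ (pow_pos hbQ 2), inv_mul_le_iff₀ hden]
    -- `(b₀Q₀)² ≤ 3C₀C68(b₀Q₀)·σ²`, i.e. `b₀Q₀ ≤ 3C₀C68·σ²`, i.e. `b₀Q₀·W² ≤ 3C₀C68·a₁²`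
    have hσa : σ ^ 2 * (2 * (L : ℝ) ^ 2 * B) ^ 2 = a₁ ^ 2 := by rw [← mul_pow, hσW]
    have h1 : 𝔠.b₀ * Q0 𝔠.p₀ ≤ 3 * C0 3 * 𝔠.C68 * σ ^ 2 := by
      have hW2 : 0 < (2 * (L : ℝ) ^ 2 * B) ^ 2 := pow_pos hW 2
      refine le_of_mul_le_mul_right ?_ hW2
      calc 𝔠.b₀ * Q0 𝔠.p₀ * (2 * (L : ℝ) ^ 2 * B) ^ 2 ≤ 3 * C0 3 * 𝔠.C68 * a₁ ^ 2 := hCa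
        _ = 3 * C0 3 * 𝔠.C68 * σ ^ 2 * (2 * (L : ℝ) ^ 2 * B) ^ 2 := by rw [← hσa]; ring
    calc (𝔠.b₀ * Q0 𝔠.p₀) ^ 2 = (𝔠.b₀ * Q0 𝔠.p₀) * (𝔠.b₀ * Q0 𝔠.p₀) := sq _
      _ ≤ (𝔠.b₀ * Q0 𝔠.p₀) * (3 * C0 3 * 𝔠.C68 * σ ^ 2) := mul_le_mul_of_nonneg_left h1 hbQ.le
      _ = 3 * C0 3 * 𝔠.C68 * (𝔠.b₀ * Q0 𝔠.p₀) * σ ^ 2 := by ring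
  have hthr : ((3 * C0 3 * 𝔠.C68 * (𝔠.b₀ * Q0 𝔠.p₀))⁻¹) ^ 2 ≤ ((σ / (𝔠.b₀ * Q0 𝔠.p₀)) ^ 2) ^ 2 :=
    pow_le_pow_left₀ (inv_pos.mpr hden).le hkey 2
  have hγσ : γ ≤ ((σ / (𝔠.b₀ * Q0 𝔠.p₀)) ^ 2) ^ 2 := window_le_of_C68 𝔠 hγ1 hthr
  have hθ : θBal L γ 𝔠.b₀ 𝔠.p₀ (K - k + 1) ≤ σ :=
    θBal_le_of_le_gamma hL 𝔠.b₀_pos 𝔠.p₀_pos hσ hγ hγ1' hγσ (K - k + 1)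
  calc 2 * (L : ℝ) ^ 2 * B * θBal L γ 𝔠.b₀ 𝔠.p₀ (K - k + 1) ≤ 2 * (L : ℝ) ^ 2 * B * σ := mul_le_mul_of_nonneg_left hθ hW.le
    _ = a₁ := by rw [mul_comm, hσW]

/-- **ALL THREE `C68`-ROWS FROM ONE EXPLICIT LOWER BOUND** `C68 ≥ c_min(L, B₃, B, a₁, b₀, p₀) := max (4B₃L²B) (max (e^{p₀−1}/(3C₀(3)b₀Q₀(p₀))) (b₀Q₀(p₀)(2L²B)²/(3C₀(3)a₁²)))`
(pure real arithmetic; `a₁, b₀Q₀(p₀) > 0`). [cite: Balaban1985UV3, (68)–(71) p.273 (bookkeeping: the free O(1) constant of (68))] -/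
theorem sizes_of_C68_ge {L' : ℕ} {B₃ B a₁ b₀ p₀ C : ℝ} (ha₁ : 0 < a₁) (hb : 0 < b₀) (hp : 0 < p₀)
    (hC : max (4 * B₃ * (L' : ℝ) ^ 2 * B)
      (max (Real.exp (p₀ - 1) / (3 * C0 3 * (b₀ * Q0 p₀))) ((b₀ * Q0 p₀) * (2 * (L' : ℝ) ^ 2 * B) ^ 2 / (3 * C0 3 * a₁ ^ 2))) ≤ C) :
    4 * B₃ * (L' : ℝ) ^ 2 * B ≤ C ∧ Real.exp (p₀ - 1) ≤ 3 * C0 3 * C * (b₀ * Q0 p₀) ∧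
      (b₀ * Q0 p₀) * (2 * (L' : ℝ) ^ 2 * B) ^ 2 ≤ 3 * C0 3 * C * a₁ ^ 2 := by
  have hC0 := C0_pos 3
  have hbQ : 0 < b₀ * Q0 p₀ := mul_pos hb (Q0_pos hp)
  obtain ⟨h1, h23⟩ := max_le_iff.mp hC
  obtain ⟨h2, h3⟩ := max_le_iff.mp h23
  refine ⟨h1, ?_, ?_⟩
  · rw [div_le_iff₀ (by positivity)] at h2
    calc Real.exp (p₀ - 1) ≤ C * (3 * C0 3 * (b₀ * Q0 p₀)) := h2
      _ = 3 * C0 3 * C * (b₀ * Q0 p₀) := by ring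
  · rw [div_le_iff₀ (by positivity)] at h3
    calc (b₀ * Q0 p₀) * (2 * (L' : ℝ) ^ 2 * B) ^ 2 ≤ C * (3 * C0 3 * a₁ ^ 2) := h3
      _ = 3 * C0 3 * C * a₁ ^ 2 := by ring

end ClosedForm

end Summit.QuantumFields.YangMills.Theorems.MinimiserPin

namespace Summit.QuantumFields.YangMills.Theorems

open MeasureTheory
open scoped Matrix.Norms.L2Operator
open Literature.MathematicalPhysics.QuantumFieldTheory.Balaban1983to89
open Literature.MathematicalPhysics.QuantumFieldTheory.Balaban1983to89.T3ContinuumYM3Torus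
open Literature.MathematicalPhysics.QuantumFieldTheory.Balaban1983to89.T3UnitScaleTilt (θBal)
open Literature.MathematicalPhysics.QuantumFieldTheory.Balaban1983to89.T3PrintedMinimiserExistence (Thm1GlobalMinAt)
open Literature.MathematicalPhysics.QuantumFieldTheory.Balaban1983to89.T3Thresholds (sqrt_le_exp_iff)
open Literature.MathematicalPhysics.QuantumFieldTheory.Balaban1983to89.ExpMeanLog (deltaSU)
open Literature.MathematicalPhysics.QuantumFieldTheory.Balaban1985CMP102.Setting
open Summit.QuantumFields.Balaban3D.Carriers
open Summit.QuantumFields.Balaban3D.Proofs.Primitives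
open Summit.QuantumFields.Balaban3D.Proofs.Thresholds (Q0 Q0_pos)
open B7Prop2Explicit (C0 C0_pos)

/-! ## §2 The knit in closed form, with the print-strength data row (O″) -/

section Family

variable (F : T3Family) (𝔠 : AlphaConsts F.L (suGroupModel 2).N)

/-- **(O∀) ⇒ (O″)**: the knit's universal data row «data rows for EVERY pinned family» implies the print-strength row «given that some pinned family exists,
data rows for SOME pinned family» (take the same family). [cite: Balaban1985UV3, Thm 2 p.272 and (41) p.266 (bookkeeping)] -/
theorem AlphaInputsT3AC.dataRowsGiven_of_forall {γ : ℝ} {hγ : 0 < γ} {hγ1 : γ ≤ (min 𝔠.gamma0 1) ^ 2} {a₀ a₁ : ℝ} {K : ℕ}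
    (hrows : ∀ Ut : (k : ℕ) → GaugeField (F.P K) k (Matrix.specialUnitaryGroup (Fin 2) ℂ) → GaugeField (F.P K) 0 (Matrix.specialUnitaryGroup (Fin 2) ℂ),
      AlphaInputsT3AC.TrivMinimiserRowsT3 F 𝔠 γ hγ hγ1 a₀ a₁ K Ut → AlphaInputsT3AC.DataRowsT3 F 𝔠 γ hγ hγ1 K Ut)
    (hex : ∃ Ut : (k : ℕ) → GaugeField (F.P K) k (Matrix.specialUnitaryGroup (Fin 2) ℂ) → GaugeField (F.P K) 0 (Matrix.specialUnitaryGroup (Fin 2) ℂ),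
      AlphaInputsT3AC.TrivMinimiserRowsT3 F 𝔠 γ hγ hγ1 a₀ a₁ K Ut) :
    ∃ Ut : (k : ℕ) → GaugeField (F.P K) k (Matrix.specialUnitaryGroup (Fin 2) ℂ) → GaugeField (F.P K) 0 (Matrix.specialUnitaryGroup (Fin 2) ℂ),
      AlphaInputsT3AC.TrivMinimiserRowsT3 F 𝔠 γ hγ hγ1 a₀ a₁ K Ut ∧ AlphaInputsT3AC.DataRowsT3 F 𝔠 γ hγ hγ1 K Ut := by
  obtain ⟨Ut, hUt⟩ := hex
  exact ⟨Ut, hUt, hrows Ut hUt⟩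

/-- ★★ **LANE B's DISPLAYED SCHEMA FROM [7] THEOREM 1, (D6), THE PRINT-STRENGTH DATA ROW (O″), AND SIZES IN CLOSED FORM.**  As `…dataSchemaT3AC_of_pinnedRows`
(sibling `…MinimiserPinKnit`) with: the two `γ`-rows replaced by the two `C68`-inequalities of §1, and the data row weakened to (O″) «`(∃ Ut, Triv… Ut) → ∃ Ut,
Triv… Ut ∧ Data… Ut`». [cite: Balaban1985Variational, Thm 1 (6)–(8) pp.278–279; Balaban1985UV3, (40)–(42) p.266, (68) p.273 and Thm 2 p.272] -/
theorem AlphaInputsT3AC.dataSchemaT3AC_of_pinnedRows₂ {a₀ a₁ : ℝ}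
    (hT : Thm1GlobalMinAt F.L a₀ a₁ 𝔠.B₃) (ha₁ : 0 < a₁) (hwin : 𝔠.B₃ * a₁ ≤ a₀)
    (hA3 : (143 * ((((3 + 4 : ℕ) : ℝ)) ^ 2 / 4) ^ 2) * (2 * (𝔠.B₃ * a₁)) ≤ 1 / 3)
    (hA2 : 2 * (2 * (𝔠.B₃ * a₁)) ≤ 2 * deltaSU (Fin 2) / (((3 + 4) * F.L : ℕ) : ℝ) ^ 2)
    (hB₃ : 1 ≤ 2 * 𝔠.B₃) (hC : 4 * 𝔠.B₃ * (F.L : ℝ) ^ 2 * avgWindowFactor F.L ≤ 𝔠.C68)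
    (hCe : Real.exp (𝔠.p₀ - 1) ≤ 3 * C0 3 * 𝔠.C68 * (𝔠.b₀ * Q0 𝔠.p₀))
    (hCa : (𝔠.b₀ * Q0 𝔠.p₀) * (2 * (F.L : ℝ) ^ 2 * avgWindowFactor F.L) ^ 2 ≤ 3 * C0 3 * 𝔠.C68 * a₁ ^ 2)
    (hD6 : ∀ (γ : ℝ) (hγ : 0 < γ) (hγ1 : γ ≤ (min 𝔠.gamma0 1) ^ 2) (K : ℕ), AlphaInputsT3AC.AdaptedClassNonemptyT3 F 𝔠 γ hγ hγ1 K)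
    (hrows : ∀ (γ : ℝ) (hγ : 0 < γ) (hγ1 : γ ≤ (min 𝔠.gamma0 1) ^ 2) (K : ℕ),
      (∃ Ut : (k : ℕ) → GaugeField (F.P K) k (Matrix.specialUnitaryGroup (Fin 2) ℂ) → GaugeField (F.P K) 0 (Matrix.specialUnitaryGroup (Fin 2) ℂ),
        AlphaInputsT3AC.TrivMinimiserRowsT3 F 𝔠 γ hγ hγ1 a₀ a₁ K Ut) →
      ∃ Ut : (k : ℕ) → GaugeField (F.P K) k (Matrix.specialUnitaryGroup (Fin 2) ℂ) → GaugeField (F.P K) 0 (Matrix.specialUnitaryGroup (Fin 2) ℂ),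
        AlphaInputsT3AC.TrivMinimiserRowsT3 F 𝔠 γ hγ hγ1 a₀ a₁ K Ut ∧ AlphaInputsT3AC.DataRowsT3 F 𝔠 γ hγ hγ1 K Ut) :
    DataSchemaT3AC F 𝔠 a₀ a₁ := by
  have hL1 : 1 ≤ F.L := by have := F.hL.2; omega
  have hanti := MinimiserPin.anti_of_C68 𝔠 hCe
  have hsmall := MinimiserPin.small_of_C68 𝔠 hL1 ha₁ (avgWindowFactor_pos F) hCa
  intro γ hγ hγ1 K
  have hγ1' : γ ≤ 1 := hγ1.trans (sq_min_one_le _ 𝔠.gamma0_pos)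
  have hγe : Real.sqrt γ ≤ Real.exp (1 - 𝔠.p₀) := (sqrt_le_exp_iff hγ.le).mpr (hγ1.trans hanti)
  have hw0 : 0 ≤ (F.L : ℝ) ^ 2 * avgWindowFactor F.L := by
    have := avgWindowFactor_pos F
    positivity
  have hC2 : 2 * (F.L : ℝ) ^ 2 * avgWindowFactor F.L ≤ 𝔠.C68 := by nlinarith
  refine ⟨MinimiserPin.windowIneqT3_of_le F 𝔠 hγ hγ1' hγe hC2 K, hD6 γ hγ hγ1 K, hrows γ hγ hγ1 K ?_⟩
  exact AlphaInputsT3AC.trivMinimiserRowsT3_of_thm1GlobalMinAt F 𝔠 γ hγ hγ1 K hT hwin hA3 hA2 hB₃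
    (fun k _ => hsmall γ hγ hγ1 K k)
    (fun k i hik hkK => MinimiserPin.C68_dom_of_le hL1 hγ hγ1' hγe 𝔠.b₀_pos 𝔠.p₀_pos.le (avgWindowFactor_pos F).le
      𝔠.B₃_pos.le hC K k i hik hkK)

/-- ★★ **THE v3 (α) PACKAGE FROM THE SAME** (through lane B's `AlphaInputsT3AC.ofV3At_of_dataSchemaT3`).
[cite: Balaban1985UV3, Thm 2 p.272; Balaban1985Variational, Thm 1 (8) p.279] -/
theorem AlphaInputsT3AC.ofV3At_of_pinnedRows₂ {a₀ a₁ : ℝ}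
    (hT : Thm1GlobalMinAt F.L a₀ a₁ 𝔠.B₃) (ha₁ : 0 < a₁) (hwin : 𝔠.B₃ * a₁ ≤ a₀)
    (hA3 : (143 * ((((3 + 4 : ℕ) : ℝ)) ^ 2 / 4) ^ 2) * (2 * (𝔠.B₃ * a₁)) ≤ 1 / 3)
    (hA2 : 2 * (2 * (𝔠.B₃ * a₁)) ≤ 2 * deltaSU (Fin 2) / (((3 + 4) * F.L : ℕ) : ℝ) ^ 2)
    (hB₃ : 1 ≤ 2 * 𝔠.B₃) (hC : 4 * 𝔠.B₃ * (F.L : ℝ) ^ 2 * avgWindowFactor F.L ≤ 𝔠.C68)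
    (hCe : Real.exp (𝔠.p₀ - 1) ≤ 3 * C0 3 * 𝔠.C68 * (𝔠.b₀ * Q0 𝔠.p₀))
    (hCa : (𝔠.b₀ * Q0 𝔠.p₀) * (2 * (F.L : ℝ) ^ 2 * avgWindowFactor F.L) ^ 2 ≤ 3 * C0 3 * 𝔠.C68 * a₁ ^ 2)
    (hD6 : ∀ (γ : ℝ) (hγ : 0 < γ) (hγ1 : γ ≤ (min 𝔠.gamma0 1) ^ 2) (K : ℕ), AlphaInputsT3AC.AdaptedClassNonemptyT3 F 𝔠 γ hγ hγ1 K)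
    (hrows : ∀ (γ : ℝ) (hγ : 0 < γ) (hγ1 : γ ≤ (min 𝔠.gamma0 1) ^ 2) (K : ℕ),
      (∃ Ut : (k : ℕ) → GaugeField (F.P K) k (Matrix.specialUnitaryGroup (Fin 2) ℂ) → GaugeField (F.P K) 0 (Matrix.specialUnitaryGroup (Fin 2) ℂ),
        AlphaInputsT3AC.TrivMinimiserRowsT3 F 𝔠 γ hγ hγ1 a₀ a₁ K Ut) →
      ∃ Ut : (k : ℕ) → GaugeField (F.P K) k (Matrix.specialUnitaryGroup (Fin 2) ℂ) → GaugeField (F.P K) 0 (Matrix.specialUnitaryGroup (Fin 2) ℂ),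
        AlphaInputsT3AC.TrivMinimiserRowsT3 F 𝔠 γ hγ hγ1 a₀ a₁ K Ut ∧ AlphaInputsT3AC.DataRowsT3 F 𝔠 γ hγ hγ1 K Ut) :
    AlphaInputsT3AC.OfV3At F 𝔠 a₀ a₁ :=
  AlphaInputsT3AC.ofV3At_of_dataSchemaT3
    (AlphaInputsT3AC.dataSchemaT3AC_of_pinnedRows₂ F 𝔠 hT ha₁ hwin hA3 hA2 hB₃ hC hCe hCa hD6 hrows)

end Family

/-! ## §3 Record level: ONE displayed predicate for the registered 2′ text -/

section Record

/-- **`AlphaInputsT3AC.PinnedPartsT3ACRec L` — 2′'s DISPLAY AS ONE PREDICATE** (hypothesis schema, OPEN, never asserted): the quantifier shell of the registered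
text `AlphaInputsT3ACv3Rec L` VERBATIM — thresholds `b₁, p₁` such that for every profile `(b₀, p₀)` beyond them there is a primitive-constants record `𝔠` with
EXACTLY that p-function and [Balaban1985Variational] constants `a₀, a₁` (`0 < a₀`, `0 < a₁`, `B₃a₁ ≤ a₀`) — whose body is:
* [7]'s small-`a₁` regime: `2B₃a₁` admissible for [Balaban1985Averaging] Prop. 2 on the `7L`-cubes of `SU(2)` (`143·(7²/4)²·2B₃a₁ ≤ ⅓`, `4B₃a₁ ≤ 2δ_SU(2)/(7L)²`);
* the record's sizes: `1 ≤ 2B₃` and `C68 ≥ c_min` as three inequalities LINEAR in the free (68)-constant — `4B₃L²·avgWindowFactor(L) ≤ C68`,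
  `e^{p₀−1} ≤ 3C₀(3)·C68·b₀Q₀(p₀)`, `b₀Q₀(p₀)·(2L²·avgWindowFactor(L))² ≤ 3C₀(3)·C68·a₁²` (always attainable: `AlphaInputsT3AC.exists_record_sizes`);
* (T) [Balaban1985Variational] Thm 1 + Prop 7 in the tree's global reading, `Thm1GlobalMinAt L a₀ a₁ 𝔠.B₃` (a minimiser over (6) exists inside (8));
* for every three-torus family of block size `L`, every coupling of the record's window and every run: (D6) the adapted classes are non-empty, and (O″) GIVEN a
  measurable pinned trivial-history minimiser family with (D5), the cluster-expansion data rows (D1)–(D4), (D7) hold for SOME such family.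
[cite: Balaban1985UV3, (7) p.257, (40)–(42) p.266, (68) p.273 and Thm 2 p.272; Balaban1985Variational, Thm 1 (6)–(8) pp.278–279; Balaban1985Averaging, Prop. 2 p.22] -/
def AlphaInputsT3AC.PinnedPartsT3ACRec (L : ℕ) : Prop :=
  ∃ (b₁ p₁ : ℝ), ∀ (b₀ p₀ : ℝ), b₁ ≤ b₀ → p₁ ≤ p₀ →
    ∃ (𝔠 : AlphaConsts L (suGroupModel 2).N) (a₀ a₁ : ℝ), 𝔠.b₀ = b₀ ∧ 𝔠.p₀ = p₀ ∧ 0 < a₀ ∧ 0 < a₁ ∧ 𝔠.B₃ * a₁ ≤ a₀ ∧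
      (143 * ((((3 + 4 : ℕ) : ℝ)) ^ 2 / 4) ^ 2) * (2 * (𝔠.B₃ * a₁)) ≤ 1 / 3 ∧
      2 * (2 * (𝔠.B₃ * a₁)) ≤ 2 * deltaSU (Fin 2) / (((3 + 4) * L : ℕ) : ℝ) ^ 2 ∧
      1 ≤ 2 * 𝔠.B₃ ∧ 4 * 𝔠.B₃ * (L : ℝ) ^ 2 * avgWindowFactor L ≤ 𝔠.C68 ∧
      Real.exp (𝔠.p₀ - 1) ≤ 3 * C0 3 * 𝔠.C68 * (𝔠.b₀ * Q0 𝔠.p₀) ∧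
      (𝔠.b₀ * Q0 𝔠.p₀) * (2 * (L : ℝ) ^ 2 * avgWindowFactor L) ^ 2 ≤ 3 * C0 3 * 𝔠.C68 * a₁ ^ 2 ∧
      Thm1GlobalMinAt L a₀ a₁ 𝔠.B₃ ∧
      ∀ (F : T3Family) (hF : F.L = L),
        (∀ (γ : ℝ) (hγ : 0 < γ) (hγ1 : γ ≤ (min (hF ▸ 𝔠).gamma0 1) ^ 2) (K : ℕ),
          AlphaInputsT3AC.AdaptedClassNonemptyT3 F (hF ▸ 𝔠) γ hγ hγ1 K) ∧
        (∀ (γ : ℝ) (hγ : 0 < γ) (hγ1 : γ ≤ (min (hF ▸ 𝔠).gamma0 1) ^ 2) (K : ℕ),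
          (∃ Ut : (k : ℕ) → GaugeField (F.P K) k (Matrix.specialUnitaryGroup (Fin 2) ℂ) → GaugeField (F.P K) 0 (Matrix.specialUnitaryGroup (Fin 2) ℂ),
            AlphaInputsT3AC.TrivMinimiserRowsT3 F (hF ▸ 𝔠) γ hγ hγ1 a₀ a₁ K Ut) →
          ∃ Ut : (k : ℕ) → GaugeField (F.P K) k (Matrix.specialUnitaryGroup (Fin 2) ℂ) → GaugeField (F.P K) 0 (Matrix.specialUnitaryGroup (Fin 2) ℂ),
            AlphaInputsT3AC.TrivMinimiserRowsT3 F (hF ▸ 𝔠) γ hγ hγ1 a₀ a₁ K Ut ∧ AlphaInputsT3AC.DataRowsT3 F (hF ▸ 𝔠) γ hγ hγ1 K Ut)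

/-- At a family of block size `L` the body of `PinnedPartsT3ACRec` gives lane B's displayed data schema (§2 after transport along `hF`).
[cite: Balaban1985UV3, Thm 2 p.272; Balaban1985Variational, Thm 1 (8) p.279] -/
theorem AlphaInputsT3AC.dataSchemaT3AC_of_pinnedParts_cast {L : ℕ} {𝔠 : AlphaConsts L (suGroupModel 2).N} {a₀ a₁ : ℝ}
    (ha₁ : 0 < a₁) (hwin : 𝔠.B₃ * a₁ ≤ a₀)
    (hA3 : (143 * ((((3 + 4 : ℕ) : ℝ)) ^ 2 / 4) ^ 2) * (2 * (𝔠.B₃ * a₁)) ≤ 1 / 3)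
    (hA2 : 2 * (2 * (𝔠.B₃ * a₁)) ≤ 2 * deltaSU (Fin 2) / (((3 + 4) * L : ℕ) : ℝ) ^ 2)
    (hB₃ : 1 ≤ 2 * 𝔠.B₃) (hC : 4 * 𝔠.B₃ * (L : ℝ) ^ 2 * avgWindowFactor L ≤ 𝔠.C68)
    (hCe : Real.exp (𝔠.p₀ - 1) ≤ 3 * C0 3 * 𝔠.C68 * (𝔠.b₀ * Q0 𝔠.p₀))
    (hCa : (𝔠.b₀ * Q0 𝔠.p₀) * (2 * (L : ℝ) ^ 2 * avgWindowFactor L) ^ 2 ≤ 3 * C0 3 * 𝔠.C68 * a₁ ^ 2)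
    (hT : Thm1GlobalMinAt L a₀ a₁ 𝔠.B₃) (F : T3Family) (hF : F.L = L)
    (hD6 : ∀ (γ : ℝ) (hγ : 0 < γ) (hγ1 : γ ≤ (min (hF ▸ 𝔠).gamma0 1) ^ 2) (K : ℕ),
      AlphaInputsT3AC.AdaptedClassNonemptyT3 F (hF ▸ 𝔠) γ hγ hγ1 K)
    (hrows : ∀ (γ : ℝ) (hγ : 0 < γ) (hγ1 : γ ≤ (min (hF ▸ 𝔠).gamma0 1) ^ 2) (K : ℕ),
      (∃ Ut : (k : ℕ) → GaugeField (F.P K) k (Matrix.specialUnitaryGroup (Fin 2) ℂ) → GaugeField (F.P K) 0 (Matrix.specialUnitaryGroup (Fin 2) ℂ),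
        AlphaInputsT3AC.TrivMinimiserRowsT3 F (hF ▸ 𝔠) γ hγ hγ1 a₀ a₁ K Ut) →
      ∃ Ut : (k : ℕ) → GaugeField (F.P K) k (Matrix.specialUnitaryGroup (Fin 2) ℂ) → GaugeField (F.P K) 0 (Matrix.specialUnitaryGroup (Fin 2) ℂ),
        AlphaInputsT3AC.TrivMinimiserRowsT3 F (hF ▸ 𝔠) γ hγ hγ1 a₀ a₁ K Ut ∧ AlphaInputsT3AC.DataRowsT3 F (hF ▸ 𝔠) γ hγ hγ1 K Ut) :
    DataSchemaT3AC F (hF ▸ 𝔠) a₀ a₁ := by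
  subst hF
  exact AlphaInputsT3AC.dataSchemaT3AC_of_pinnedRows₂ F 𝔠 hT ha₁ hwin hA3 hA2 hB₃ hC hCe hCa hD6 hrows

/-- **2′'s DISPLAY IMPLIES LANE B's RECORD-PARAMETRIC DATA SCHEMA**: `PinnedPartsT3ACRec L → DataSchemaT3ACRec L` (same shell; §2 per family).
[cite: Balaban1985UV3, Thm 2 p.272; Balaban1985Variational, Thm 1 (8) p.279] -/
theorem dataSchemaT3ACRec_of_pinnedPartsRec {L : ℕ} (h : AlphaInputsT3AC.PinnedPartsT3ACRec L) : DataSchemaT3ACRec L := by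
  obtain ⟨b₁, p₁, h⟩ := h
  refine ⟨b₁, p₁, fun b₀ p₀ hb hp => ?_⟩
  obtain ⟨𝔠, a₀, a₁, h1, h2, h3, h4, h5, hA3, hA2, hB₃, hC, hCe, hCa, hT, hD⟩ := h b₀ p₀ hb hp
  exact ⟨𝔠, a₀, a₁, h1, h2, h3, h4, h5, fun F hF =>
    AlphaInputsT3AC.dataSchemaT3AC_of_pinnedParts_cast h4 h5 hA3 hA2 hB₃ hC hCe hCa hT F hF (hD F hF).1 (hD F hF).2⟩

/-- ★★★ **THE REGISTERED 2′ TEXT FROM ITS DISPLAY**: `AlphaInputsT3AC.PinnedPartsT3ACRec L → AlphaInputsT3ACv3Rec L` — 2′ `stub_laneRecordsV3` re-cut to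
«(T) [7] Thm 1 + (D6) non-emptiness + (O″) the data rows, at a record with exact profile, small `a₁` and `C68 ≥ c_min`» (lane B's `alphaInputsT3ACv3Rec_of_dataSchemaRec`
after `dataSchemaT3ACRec_of_pinnedPartsRec`). [cite: Balaban1985UV3, Thm 2 p.272; Balaban1985Variational, Thm 1 (8) p.279] -/
theorem alphaInputsT3ACv3Rec_of_pinnedPartsRec {L : ℕ} (h : AlphaInputsT3AC.PinnedPartsT3ACRec L) : AlphaInputsT3ACv3Rec L :=
  alphaInputsT3ACv3Rec_of_dataSchemaRec (dataSchemaT3ACRec_of_pinnedPartsRec h)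

end Record

/-! ## §4 The size rows are never the obstruction: records with exact profile and all `C68`-sizes exist -/

section Sizes

/-- ★ **RECORDS WITH EXACT PROFILE AND ALL THREE `C68`-SIZES EXIST BEYOND A THRESHOLD.**  For every record `𝔠₀` and every `a₁ > 0` there is `b₁` such that for
all `b₀ ≥ b₁`, `p₀ ≥ 3` there is a record `𝔠` with `𝔠.b₀ = b₀`, `𝔠.p₀ = p₀`, `𝔠.B₃ = 𝔠₀.B₃`, and `4B₃L²·avgWindowFactor(L) ≤ C68`,
`e^{p₀−1} ≤ 3C₀(3)·C68·b₀Q₀(p₀)`, `b₀Q₀(p₀)·(2L²·avgWindowFactor(L))² ≤ 3C₀(3)·C68·a₁²` (alpha-2's `exists_alphaConsts_profile` with `c := c_min` of §1 at the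
target profile) — so in `PinnedPartsT3ACRec L` the size rows cost the data provider nothing beyond naming `𝔠` with `C68` large, and `1 ≤ 2B₃` is inherited from
`𝔠₀`. [cite: Balaban1985UV3, (7) p.257 and (68) p.273 (bookkeeping)] -/
theorem AlphaInputsT3AC.exists_record_sizes {L N : ℕ} (𝔠₀ : AlphaConsts L N) {a₁ : ℝ} (ha₁ : 0 < a₁) :
    ∃ b₁ : ℝ, 0 ≤ b₁ ∧ ∀ (b₀ p₀ : ℝ), b₁ ≤ b₀ → 3 ≤ p₀ →
      ∃ 𝔠 : AlphaConsts L N, 𝔠.b₀ = b₀ ∧ 𝔠.p₀ = p₀ ∧ 𝔠.B₃ = 𝔠₀.B₃ ∧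
        4 * 𝔠.B₃ * (L : ℝ) ^ 2 * avgWindowFactor L ≤ 𝔠.C68 ∧
        Real.exp (𝔠.p₀ - 1) ≤ 3 * C0 3 * 𝔠.C68 * (𝔠.b₀ * Q0 𝔠.p₀) ∧
        (𝔠.b₀ * Q0 𝔠.p₀) * (2 * (L : ℝ) ^ 2 * avgWindowFactor L) ^ 2 ≤ 3 * C0 3 * 𝔠.C68 * a₁ ^ 2 := by
  obtain ⟨b₁, hb₁, h⟩ := AlphaInputsT3AC.exists_alphaConsts_profile 𝔠₀
  refine ⟨b₁, hb₁, fun b₀ p₀ hb hp => ?_⟩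
  -- the explicit threshold of §1 at the target profile
  obtain ⟨𝔠, h1, h2, hc, -, hB, -⟩ := h b₀ p₀
    (max (4 * 𝔠₀.B₃ * (L : ℝ) ^ 2 * avgWindowFactor L)
      (max (Real.exp (p₀ - 1) / (3 * C0 3 * (b₀ * Q0 p₀)))
        ((b₀ * Q0 p₀) * (2 * (L : ℝ) ^ 2 * avgWindowFactor L) ^ 2 / (3 * C0 3 * a₁ ^ 2)))) hb hp
  have hb0 : 0 < b₀ := h1 ▸ 𝔠.b₀_pos
  have hp0 : 0 < p₀ := h2 ▸ 𝔠.p₀_pos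
  obtain ⟨s1, s2, s3⟩ := MinimiserPin.sizes_of_C68_ge (B₃ := 𝔠₀.B₃) (B := avgWindowFactor L) ha₁ hb0 hp0 hc
  refine ⟨𝔠, h1, h2, hB, ?_, ?_, ?_⟩
  · rw [hB]; exact s1
  · rw [h1, h2]; exact s2
  · rw [h1, h2]; exact s3

end Sizes

end Summit.QuantumFields.YangMills.Theorems

end
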